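import Summits.KontsevichZagierPeriods.KontsevichZagierPeriods.Theorems.HurwitzMicroSectorsNormalFormPrincipleW3PowerSubstitution
import Summits.KontsevichZagierPeriods.KontsevichZagierPeriods.Theorems.HurwitzMicroSectorsNormalFormPrincipleW3ExistsBoxBand
import Summits.KontsevichZagierPeriods.KontsevichZagierPeriods.Theorems.HurwitzMicroSectorsAperySectorThreeTwo

/-!
# `NormalFormPrinciple` (stmt-KontsevichZagierPeriods-3869), line `SketchIdeator1` — leaf `stub_boxRigidity`:
# WEIGHT THREE, FULLY RESONANT BOXES WITH `2θ ∈ ℤ` JOIN THE APÉRY SECTOR (rule 2), unconditionally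

A weight-three monomial box `[(0,1)³, c x^a y^b z^d/(1 − x^{k₁} y^{k₂} z^{k₃})]`, `c ∈ ℚ`, is FULLY
RESONANT when `θ := (a+1)/k₁ = (b+1)/k₂ = (d+1)/k₃`; its value is `(c/(k₁k₂k₃))·ζ(3, θ)`-like. When
`θ = j/ℓ` with `ℓ ∈ {1, 2}` (i.e. `kᵢ = ℓ kᵢ'`, `eᵢ + 1 = j kᵢ'`) the power substitution
`(X,Y,Z) ↦ (X^{k₁'}, Y^{k₂'}, Z^{k₃'})` (rule 2, `power_substitution3`) turns it into the diagonal box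
`[(0,1)³, (c/(k₁'k₂'k₃')) (xyz)^{j−1}/(1 − (xyz)^ℓ)]`, a representation of the route's Apéry sector
`(3,2)` (`P(t)/(1 − t²)`, `t = xyz`: `P = c' t^{j−1}` for `ℓ = 2`, `P = c' t^{j−1}(1 + t)` for `ℓ = 1`),
on which the route's CLOSED crux `AperySectorThreeTwo` (Apéry's theorem `ζ(3) ∉ ℚ`, proved in the
tree) decides equivalence by value. Hence two such boxes with equal values are KZ-equivalent, and so
is such a box against any sector representation (`resonant3_equivalent_of_value_eq`,
`resonant3_equivalent_sector_of_value_eq`) — e.g. `∫∫∫ y z/(1 − x y² z²)` (`θ = 1`, value `ζ(3)/4`)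
against `∫∫∫ dxdydz/(4(1 − xyz))`. The remaining resonant weight-three boxes (`2θ ∉ ℤ`, or only two
`θ`'s equal) mix `ζ(2,θ)`, `ζ(3,θ)` with logarithms and are not reached.
References: M. Kontsevich, D. Zagier, *Periods* (2001), §1.2; R. Apéry (1979), as landed
(`AperySectorThreeTwo_of`). No new definitions.
-/

noncomputable section

open MeasureTheory Set
open scoped Polynomial
open Literature.NumberTheory.Transcendental Literature.NumberTheory.Transcendental.KZ
open Literature.ModelTheory.ExponentialFields (IsSemialgebraic)

namespace Summit.KontsevichZagierPeriods.HurwitzMicroSectors.NormalFormPrinciple.PiBox.Weight3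

open Summit.KontsevichZagierPeriods.Theorems.AperySectorThreeTwo (AperySectorThreeTwo_of)

/-- **A fully resonant box with `2θ ∈ ℤ` is a sector representation** (one power substitution):
for `ℓ ∈ {1,2}`, `j ≥ 1`, `eᵢ + 1 = j kᵢ'`, the box `[(0,1)³, c Π xᵢ^{eᵢ}/(1 − Π xᵢ^{ℓ kᵢ'})]` differs by a
relation from a representation `M` on `(0,1)³` with integrand `P(xyz)/(1 − (xyz)²)`, `P ∈ ℚ[t]`.
[cite: KontsevichZagier2001, §1.2 rule (2)] -/
theorem resonant3_sub_sector (ℓ : ℕ) (hℓ : ℓ = 1 ∨ ℓ = 2) (k₁ k₂ k₃ : ℕ) (hk₁ : 0 < k₁) (hk₂ : 0 < k₂)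
    (hk₃ : 0 < k₃) (j : ℕ) (hj : 0 < j) (a b d : ℕ) (ha : a + 1 = j * k₁) (hb : b + 1 = j * k₂)
    (hd : d + 1 = j * k₃) (c : ℚ) (N : IntegralRep 3)
    (hNd : N.domain = {x | ∀ i, x i ∈ Set.Ioo (0:ℝ) 1})
    (hNi : EqOn N.integrand (fun x => (c : ℝ) * (x 0 ^ a * x 1 ^ b * x 2 ^ d) /
      (1 - x 0 ^ (ℓ * k₁) * x 1 ^ (ℓ * k₂) * x 2 ^ (ℓ * k₃))) N.domain) :
    ∃ (P : ℚ[X]) (M : IntegralRep 3), M.domain = {x | ∀ i, x i ∈ Set.Ioo (0:ℝ) 1} ∧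
      EqOn M.integrand (fun x => (Polynomial.aeval (x 0 * x 1 * x 2) P : ℝ) /
        (1 - (x 0 * x 1 * x 2) ^ 2)) M.domain ∧ of N - of M ∈ relations := by
  set c' : ℚ := c / (k₁ * k₂ * k₃ : ℕ) with hc'def
  have hc' : IsAlgebraic ℚ ((c' : ℚ) : ℝ) := isAlgebraic_algebraMap _
  have hℓpos : 0 < ℓ := by rcases hℓ with rfl | rfl <;> norm_num
  obtain ⟨hexM, -⟩ := exists_reps3_box_band ℓ hℓpos (c' : ℝ) hc'
  obtain ⟨M, hMd, hMi⟩ := hexM (j - 1) (j - 1) (j - 1)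
  -- `N` is the pull-back of `M` under `(X,Y,Z) ↦ (X^{k₁}, Y^{k₂}, Z^{k₃})`
  have hK : ((k₁ * k₂ * k₃ : ℕ) : ℝ) ≠ 0 := by
    have : 0 < k₁ * k₂ * k₃ := Nat.mul_pos (Nat.mul_pos hk₁ hk₂) hk₃
    positivity
  have hj1 : j - 1 + 1 = j := Nat.sub_add_cancel hj
  have e := power_substitution3 k₁ k₂ k₃ hk₁ hk₂ hk₃ ℓ ℓ ℓ hℓpos hℓpos hℓpos (c' : ℝ) hc'
    (j - 1) (j - 1) (j - 1) M N hMd (fun x _ => by rw [hMi]) hNd (fun x hx => by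
      rw [hNi hx, hj1, ← ha, ← hb, ← hd, Nat.add_sub_cancel, Nat.add_sub_cancel, Nat.add_sub_cancel,
        hc'def]
      push_cast
      field_simp)
  refine ⟨?_, M, hMd, ?_, by
    have ee : of N - of M = -(of M - of N) := by abel
    rw [ee]; exact relations.neg_mem e⟩
  · exact if ℓ = 2 then Polynomial.C c' * Polynomial.X ^ (j - 1)
      else Polynomial.C c' * Polynomial.X ^ (j - 1) * (1 + Polynomial.X)
  · intro x hx
    rw [hMd] at hx
    have h0 := (hx 0).1; have h1 := (hx 1).1; have h2 := (hx 2).1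
    have h0' := (hx 0).2; have h1' := (hx 1).2; have h2' := (hx 2).2
    have ht : x 0 * x 1 * x 2 < 1 := by
      have := mul_lt_one_of_nonneg_of_lt_one_left h0.le h0' h1'.le
      calc x 0 * x 1 * x 2 < 1 * 1 := by
            exact mul_lt_mul'' (by linarith) h2' (by positivity) h2.le
        _ = 1 := by ring
    have hden1 : (1:ℝ) - x 0 * x 1 * x 2 ≠ 0 := by linarith
    have hden2 : (1:ℝ) - (x 0 * x 1 * x 2) ^ 2 ≠ 0 := by
      have : (x 0 * x 1 * x 2) ^ 2 < 1 := by
        have hp : 0 ≤ x 0 * x 1 * x 2 := by positivity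
        nlinarith
      linarith
    rw [hMi]
    beta_reduce
    rcases hℓ with rfl | rfl
    · simp only [show (1:ℕ) ≠ 2 by decide, if_false, map_mul, map_pow, Polynomial.aeval_C,
        Polynomial.aeval_X, map_add, map_one, eq_ratCast, pow_one]
      rw [div_eq_div_iff hden1 hden2]
      ring
    · simp only [if_true, map_mul, map_pow, Polynomial.aeval_C, Polynomial.aeval_X, eq_ratCast]
      congr 1
      · ring
      · ring

/-- **Two fully resonant weight-three boxes with `2θ ∈ ℤ` and equal values are KZ-equivalent**,
unconditionally (Apéry, through the route's closed crux `AperySectorThreeTwo`).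
[cite: KontsevichZagier2001, §1.2 Conjecture 1] -/
theorem resonant3_equivalent_of_value_eq (ℓ ℓ' : ℕ) (hℓ : ℓ = 1 ∨ ℓ = 2) (hℓ' : ℓ' = 1 ∨ ℓ' = 2)
    (k₁ k₂ k₃ k₁' k₂' k₃' : ℕ) (hk₁ : 0 < k₁) (hk₂ : 0 < k₂) (hk₃ : 0 < k₃) (hk₁' : 0 < k₁')
    (hk₂' : 0 < k₂') (hk₃' : 0 < k₃') (j j' : ℕ) (hj : 0 < j) (hj' : 0 < j') (a b d a' b' d' : ℕ)
    (ha : a + 1 = j * k₁) (hb : b + 1 = j * k₂) (hd : d + 1 = j * k₃)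
    (ha' : a' + 1 = j' * k₁') (hb' : b' + 1 = j' * k₂') (hd' : d' + 1 = j' * k₃') (c c' : ℚ)
    (N N' : IntegralRep 3) (hNd : N.domain = {x | ∀ i, x i ∈ Set.Ioo (0:ℝ) 1})
    (hNi : EqOn N.integrand (fun x => (c : ℝ) * (x 0 ^ a * x 1 ^ b * x 2 ^ d) /
      (1 - x 0 ^ (ℓ * k₁) * x 1 ^ (ℓ * k₂) * x 2 ^ (ℓ * k₃))) N.domain)
    (hN'd : N'.domain = {x | ∀ i, x i ∈ Set.Ioo (0:ℝ) 1})
    (hN'i : EqOn N'.integrand (fun x => (c' : ℝ) * (x 0 ^ a' * x 1 ^ b' * x 2 ^ d') /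
      (1 - x 0 ^ (ℓ' * k₁') * x 1 ^ (ℓ' * k₂') * x 2 ^ (ℓ' * k₃'))) N'.domain)
    (hv : N.value = N'.value) : Equivalent N N' := by
  obtain ⟨P, M, hMd, hMi, e⟩ := resonant3_sub_sector ℓ hℓ k₁ k₂ k₃ hk₁ hk₂ hk₃ j hj a b d ha hb hd c N
    hNd hNi
  obtain ⟨P', M', hM'd, hM'i, e'⟩ := resonant3_sub_sector ℓ' hℓ' k₁' k₂' k₃' hk₁' hk₂' hk₃' j' hj'
    a' b' d' ha' hb' hd' c' N' hN'd hN'i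
  have v : M.value = M'.value := by
    rw [← Equivalent.value_eq_holds e, ← Equivalent.value_eq_holds e', hv]
  have eM : of M - of M' ∈ relations := AperySectorThreeTwo_of M M' P P' hMd hM'd hMi hM'i v
  show of N - of N' ∈ relations
  have ee : of N - of N' = (of N - of M) + (of M - of M') - (of N' - of M') := by abel
  rw [ee]
  exact relations.sub_mem (relations.add_mem e eM) e'

/-- **A fully resonant weight-three box with `2θ ∈ ℤ` against a representation of the Apéry sector**
(e.g. `∫∫∫ yz dV/(1 − x y²z²) = ζ(3)/4` against `∫∫∫ dV/(4(1 − xyz))`): equal values imply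
KZ-equivalence, unconditionally. [cite: KontsevichZagier2001, §1.2 Conjecture 1] -/
theorem resonant3_equivalent_sector_of_value_eq (ℓ : ℕ) (hℓ : ℓ = 1 ∨ ℓ = 2) (k₁ k₂ k₃ : ℕ)
    (hk₁ : 0 < k₁) (hk₂ : 0 < k₂) (hk₃ : 0 < k₃) (j : ℕ) (hj : 0 < j) (a b d : ℕ)
    (ha : a + 1 = j * k₁) (hb : b + 1 = j * k₂) (hd : d + 1 = j * k₃) (c : ℚ) (P' : ℚ[X])
    (N M' : IntegralRep 3) (hNd : N.domain = {x | ∀ i, x i ∈ Set.Ioo (0:ℝ) 1})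
    (hNi : EqOn N.integrand (fun x => (c : ℝ) * (x 0 ^ a * x 1 ^ b * x 2 ^ d) /
      (1 - x 0 ^ (ℓ * k₁) * x 1 ^ (ℓ * k₂) * x 2 ^ (ℓ * k₃))) N.domain)
    (hM'd : M'.domain = {x | ∀ i, x i ∈ Set.Ioo (0:ℝ) 1})
    (hM'i : EqOn M'.integrand (fun x => (Polynomial.aeval (x 0 * x 1 * x 2) P' : ℝ) /
      (1 - (x 0 * x 1 * x 2) ^ 2)) M'.domain)
    (hv : N.value = M'.value) : Equivalent N M' := by
  obtain ⟨P, M, hMd, hMi, e⟩ := resonant3_sub_sector ℓ hℓ k₁ k₂ k₃ hk₁ hk₂ hk₃ j hj a b d ha hb hd c N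
    hNd hNi
  have v : M.value = M'.value := by rw [← Equivalent.value_eq_holds e, hv]
  have eM : of M - of M' ∈ relations := AperySectorThreeTwo_of M M' P P' hMd hM'd hMi hM'i v
  show of N - of M' ∈ relations
  have ee : of N - of M' = (of N - of M) + (of M - of M') := by abel
  rw [ee]
  exact relations.add_mem e eM

end Summit.KontsevichZagierPeriods.HurwitzMicroSectors.NormalFormPrinciple.PiBox.Weight3
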